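import Literature.Analysis.FluidPDE.SuitableWeakExhaustion
import Literature.Analysis.FluidPDE.SuitableWeakPressure
import HarnessLib

/-!
# Sum rule and off-domain irrelevance for weak spatial gradients

Analysis/FluidPDE support file (theorems only, no new definitions) for the tree's weak spatial
gradients of time-dependent fields, `HasWeakSpatialGradientOn Q u G` (`SuitableWeak`; CKN 1982
(2.1), Evans, *PDE*, §5.2.1), written for the discharge of [BT1] §4
(`ForwardDSSLocalLerayGradient`) but generic (any finite-dimensional inner product space `E`):

* `integral_integral_add_prod`: iterated space–time integrals of sums of integrable integrands split;
* `HasWeakSpatialGradientOn.add` (**sum rule**): `G + G'` is a weak spatial gradient of `u + u'`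
  (linearity of the defining identity `∫∫ ∂ᵥφ ⟪u, w⟫ = −∫∫ φ ⟪G v, w⟫`; each side splits because
  the integrands are a test-function factor times a locally integrable one);
* `HasWeakSpatialGradientOn.congr_eqOn`: values of `u` off `Q` are irrelevant;
* `frobeniusNormSq_add_le`: `|A + B|² ≤ 2|A|² + 2|B|²`.

Tree search: `lean search 'HasWeakSpatialGradientOn\.(add|sub|congr)'` — none (only `.ae_eq`,
`.stRescale`, `.mono`); the slice-wise whole-space notion `HasWeakGradient` has `.sub`
(`NSWeakStrongUniqueness`), not usable for space–time regions. Reused: `locallyIntegrableOn_opens_iff`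
(`SuitableWeakExhaustion`), `integrable_mul_of_locallyIntegrableOn` (`SuitableWeakPressure`),
`IsSpaceTimeTestOn.fderiv_apply_top`, `IsSpaceTimeTestOn.fderiv_slice_eq_zero_of_notMem`
(`HeatDuhamelBack`), `IsSpaceTimeTestOn.fderiv_slice_eq_zero` (`WeakSolutionProofs`).

## References

* L. C. Evans, *Partial differential equations*, 2nd ed., §5.2.1 (weak derivatives: linearity,
  locality) [Evans2010].
* L. Caffarelli, R. Kohn, L. Nirenberg, CPAM 35 (1982), (2.1) [CaffarelliKohnNirenberg1982].
-/

noncomputable section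

open MeasureTheory Set Function Filter Topology TopologicalSpace Metric Module
open scoped NNReal ENNReal InnerProductSpace RealInnerProductSpace

namespace Literature.Analysis.FluidPDE

/-! ### Sum rule for weak spatial gradients -/

section SumRule

variable {E : Type*} [NormedAddCommGroup E] [InnerProductSpace ℝ E] [FiniteDimensional ℝ E]
  [MeasurableSpace E] [BorelSpace E]

/-- Splitting an iterated space–time integral of a sum of two integrable integrands. [folklore] -/
theorem integral_integral_add_prod {F₁ F₂ : ℝ × E → ℝ} (h₁ : Integrable F₁ volume)
    (h₂ : Integrable F₂ volume) :
    ∫ t, ∫ x, (F₁ (t, x) + F₂ (t, x)) = (∫ t, ∫ x, F₁ (t, x)) + ∫ t, ∫ x, F₂ (t, x) := by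
  rw [Measure.volume_eq_prod] at h₁ h₂
  have hae : ∀ᵐ t : ℝ, ∫ x, (F₁ (t, x) + F₂ (t, x)) = (∫ x, F₁ (t, x)) + ∫ x, F₂ (t, x) := by
    filter_upwards [h₁.prod_right_ae, h₂.prod_right_ae] with t ht₁ ht₂
    exact integral_add ht₁ ht₂
  rw [integral_congr_ae hae, integral_add h₁.integral_prod_left h₂.integral_prod_left]

/-- **Sum rule.** If `G` and `G'` are weak spatial gradients of `u` and `u'` on `Q`, then `G + G'`
is a weak spatial gradient of `u + u'` on `Q` (linearity of the defining identity; the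
integrals split since each integrand is a test-function factor times a locally integrable one;
Evans, *PDE*, §5.2.1). A dot-notation extension of the accepted structure. [folklore] -/
theorem HasWeakSpatialGradientOn.add {Q : Opens (ℝ × E)} {u u' : ℝ → E → E}
    {G G' : ℝ → E → E →L[ℝ] E} (h : HasWeakSpatialGradientOn Q u G)
    (h' : HasWeakSpatialGradientOn Q u' G') :
    HasWeakSpatialGradientOn Q (fun t x => u t x + u' t x) (fun t x => G t x + G' t x) where
  locallyIntegrableOn := by
    have e : uncurry (fun t x => u t x + u' t x) = uncurry u + uncurry u' := rfl
    rw [e]; exact h.locallyIntegrableOn.add h'.locallyIntegrableOn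
  locallyIntegrableOn_grad := by
    refine locallyIntegrableOn_opens_iff.2 fun K' hK' hK'c => ?_
    have e : uncurry (fun t x => G t x + G' t x) = fun z => uncurry G z + uncurry G' z := rfl
    rw [e]
    exact (locallyIntegrableOn_opens_iff.1 h.locallyIntegrableOn_grad K' hK' hK'c).add
      (locallyIntegrableOn_opens_iff.1 h'.locallyIntegrableOn_grad K' hK' hK'c)
  integral_fderiv_mul_inner_eq φ hφ v w := by
    -- the four integrable products
    set K := tsupport (uncurry φ) with hK
    have hKc : IsCompact K := hφ.hasCompactSupport
    have hKQ : K ⊆ (Q : Set (ℝ × E)) := hφ.tsupport_subset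
    have hρ₁ : Continuous fun z : ℝ × E => fderiv ℝ (φ z.1) z.2 v :=
      ((hφ.mono le_top).fderiv_apply_top v).contDiff.continuous
    have hρ₁K : ∀ z ∉ K, (fun z : ℝ × E => fderiv ℝ (φ z.1) z.2 v) z = 0 := fun z hz => by
      show fderiv ℝ (φ z.1) z.2 v = 0
      rw [IsSpaceTimeTestOn.fderiv_slice_eq_zero_of_notMem hz]
      rfl
    have hρ₂ : Continuous fun z : ℝ × E => φ z.1 z.2 := hφ.contDiff.continuous
    have hρ₂K : ∀ z ∉ K, (fun z : ℝ × E => φ z.1 z.2) z = 0 := fun z hz =>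
      show uncurry φ z = 0 from image_eq_zero_of_notMem_tsupport hz
    have hiu : ∀ {U : ℝ → E → E}, LocallyIntegrableOn (uncurry U) (Q : Set (ℝ × E)) volume →
        LocallyIntegrableOn (fun z : ℝ × E => ⟪U z.1 z.2, w⟫) (Q : Set (ℝ × E)) volume :=
      fun hU => by
        refine locallyIntegrableOn_opens_iff.2 fun K' hK' hK'c => ?_
        exact (locallyIntegrableOn_opens_iff.1 hU K' hK' hK'c).inner_const (𝕜 := ℝ) w
    have hiG : ∀ {H : ℝ → E → E →L[ℝ] E}, LocallyIntegrableOn (uncurry H) (Q : Set (ℝ × E)) volume →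
        LocallyIntegrableOn (fun z : ℝ × E => ⟪H z.1 z.2 v, w⟫) (Q : Set (ℝ × E)) volume :=
      fun hH => by
        refine locallyIntegrableOn_opens_iff.2 fun K' hK' hK'c => ?_
        exact ((ContinuousLinearMap.apply ℝ E v).integrable_comp
          (locallyIntegrableOn_opens_iff.1 hH K' hK' hK'c)).inner_const (𝕜 := ℝ) w
    have I₁ : Integrable (fun z : ℝ × E => fderiv ℝ (φ z.1) z.2 v * ⟪u z.1 z.2, w⟫) volume := by
      simpa only [mul_comm] using
        integrable_mul_of_locallyIntegrableOn (hiu h.locallyIntegrableOn) hρ₁ hKc hKQ hρ₁K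
    have I₂ : Integrable (fun z : ℝ × E => fderiv ℝ (φ z.1) z.2 v * ⟪u' z.1 z.2, w⟫) volume := by
      simpa only [mul_comm] using
        integrable_mul_of_locallyIntegrableOn (hiu h'.locallyIntegrableOn) hρ₁ hKc hKQ hρ₁K
    have J₁ : Integrable (fun z : ℝ × E => φ z.1 z.2 * ⟪G z.1 z.2 v, w⟫) volume := by
      simpa only [mul_comm] using
        integrable_mul_of_locallyIntegrableOn (hiG h.locallyIntegrableOn_grad) hρ₂ hKc hKQ hρ₂K
    have J₂ : Integrable (fun z : ℝ × E => φ z.1 z.2 * ⟪G' z.1 z.2 v, w⟫) volume := by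
      simpa only [mul_comm] using
        integrable_mul_of_locallyIntegrableOn (hiG h'.locallyIntegrableOn_grad) hρ₂ hKc hKQ hρ₂K
    have e₁ := h.integral_fderiv_mul_inner_eq φ hφ v w
    have e₂ := h'.integral_fderiv_mul_inner_eq φ hφ v w
    calc ∫ t, ∫ x, fderiv ℝ (φ t) x v * ⟪u t x + u' t x, w⟫
        = ∫ t, ∫ x, (fderiv ℝ (φ t) x v * ⟪u t x, w⟫ + fderiv ℝ (φ t) x v * ⟪u' t x, w⟫) := by
          simp only [inner_add_left, mul_add]
      _ = (∫ t, ∫ x, fderiv ℝ (φ t) x v * ⟪u t x, w⟫) +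
            ∫ t, ∫ x, fderiv ℝ (φ t) x v * ⟪u' t x, w⟫ := integral_integral_add_prod I₁ I₂
      _ = -((∫ t, ∫ x, φ t x * ⟪G t x v, w⟫) + ∫ t, ∫ x, φ t x * ⟪G' t x v, w⟫) := by
          rw [e₁, e₂]; ring
      _ = -∫ t, ∫ x, (φ t x * ⟪G t x v, w⟫ + φ t x * ⟪G' t x v, w⟫) := by
          rw [integral_integral_add_prod J₁ J₂]
      _ = -∫ t, ∫ x, φ t x * ⟪(G t x + G' t x) v, w⟫ := by
          congr 1
          refine integral_congr_ae (Eventually.of_forall fun t => ?_)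
          refine integral_congr_ae (Eventually.of_forall fun x => ?_)
          show φ t x * ⟪G t x v, w⟫ + φ t x * ⟪G' t x v, w⟫ = φ t x * ⟪(G t x + G' t x) v, w⟫
          rw [show (G t x + G' t x) v = G t x v + G' t x v from rfl, inner_add_left, mul_add]

/-- `|A + B|² ≤ 2|A|² + 2|B|²` for the Frobenius norm. [folklore] -/
theorem frobeniusNormSq_add_le {E : Type*} [NormedAddCommGroup E] [InnerProductSpace ℝ E]
    [FiniteDimensional ℝ E] (A B : E →L[ℝ] E) :
    frobeniusNormSq (A + B) ≤ 2 * frobeniusNormSq A + 2 * frobeniusNormSq B := by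
  unfold frobeniusNormSq
  rw [Finset.mul_sum, Finset.mul_sum, ← Finset.sum_add_distrib]
  refine Finset.sum_le_sum fun i _ => ?_
  rw [show (A + B) (stdOrthonormalBasis ℝ E i) = A (stdOrthonormalBasis ℝ E i) +
    B (stdOrthonormalBasis ℝ E i) from rfl]
  set a := A (stdOrthonormalBasis ℝ E i)
  set b := B (stdOrthonormalBasis ℝ E i)
  have h2 : ‖a + b‖ ^ 2 ≤ (‖a‖ + ‖b‖) ^ 2 := pow_le_pow_left₀ (norm_nonneg _) (norm_add_le a b) 2
  nlinarith [sq_nonneg (‖a‖ - ‖b‖)]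

/-- **Values off `Q` are irrelevant**: a weak spatial gradient of `u` on `Q` is a weak spatial
gradient of any `u'` agreeing with `u` on `Q`. [folklore] -/
theorem HasWeakSpatialGradientOn.congr_eqOn {E : Type*} [NormedAddCommGroup E]
    [InnerProductSpace ℝ E] [FiniteDimensional ℝ E] [MeasurableSpace E] [BorelSpace E]
    {Q : Opens (ℝ × E)} {u u' : ℝ → E → E} {G : ℝ → E → E →L[ℝ] E}
    (h : HasWeakSpatialGradientOn Q u G)
    (heq : ∀ z ∈ (Q : Set (ℝ × E)), uncurry u' z = uncurry u z) :
    HasWeakSpatialGradientOn Q u' G where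
  locallyIntegrableOn := by
    refine locallyIntegrableOn_opens_iff.2 fun K hK hKc => ?_
    exact (locallyIntegrableOn_opens_iff.1 h.locallyIntegrableOn K hK hKc).congr_fun
      (fun z hz => (heq z (hK hz)).symm) hKc.isClosed.measurableSet
  locallyIntegrableOn_grad := h.locallyIntegrableOn_grad
  integral_fderiv_mul_inner_eq φ hφ v w := by
    rw [← h.integral_fderiv_mul_inner_eq φ hφ v w]
    refine integral_congr_ae (Eventually.of_forall fun t => ?_)
    refine integral_congr_ae (Eventually.of_forall fun x => ?_)
    by_cases hz : (t, x) ∈ (Q : Set (ℝ × E))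
    · show fderiv ℝ (φ t) x v * ⟪u' t x, w⟫ = fderiv ℝ (φ t) x v * ⟪u t x, w⟫
      rw [show u' t x = u t x from heq (t, x) hz]
    · show fderiv ℝ (φ t) x v * ⟪u' t x, w⟫ = fderiv ℝ (φ t) x v * ⟪u t x, w⟫
      rw [hφ.fderiv_slice_eq_zero hz]
      simp

end SumRule

end Literature.Analysis.FluidPDE

end
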